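import Literature.AlgebraicGeometry.AbelianSchemes.AbelianSchemeDualTransportOfBaseChangeAnyBase
import Literature.AlgebraicGeometry.AbelianSchemes.AbelianSchemeOverGlueDataLevel
import Literature.AlgebraicGeometry.AbelianSchemes.AbelianSchemeOverZariskiGluingTriple
import Literature.AlgebraicGeometry.AbelianSchemes.PolarizedAbelianSchemeWithLevelBaseChange
import HarnessLib

/-!
# Gluing POLARISED abelian schemes along a cocycle of the base: the `PolarizationChartDatum` of a cocycle datum
# (leaf (Pol) of hand (h7); consumer F-8 (8c))

Topic `AlgebraicGeometry/AbelianSchemes`; namespace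
`Literature.AlgebraicGeometry.AbelianSchemes.AbelianSchemeOver.CocycleDatum`.  Cell hodgecm-mathlib (D-0151), F-DAG
hand (h7) «Zariski gluing of `S`-objects from a cocycle»; the polarisation analogue of ★ FILE 6
`AbelianSchemeOverGlueDataLevel` (level structures), for the consumer F-8 (8c) «the universal family over the glued moduli
scheme `A⁰ = ⋃ V_R`: restrictions of ONE polarised family along open immersions + the transition isomorphisms of
triples» (price sheet §3 F-8).  INPUT: a cocycle datum `𝔊 : CocycleDatum D` of abelian schemes over glue data `D` of the
base (★ FILE 5), dual pairs `Dᵢ` and polarisations `λᵢ` of the slices `Aᵢ` ([MumfordFogartyKirwan1994, Def. 6.3]), and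
on every overlap a morphism of base-changed duals `θ̂ i j : (Âᵢ)|_{V(i,j)} → (Âⱼ)|_{V(j,i)}` over `D.t i j` carrying, with
`θ i j`, the POINCARÉ clause `(θ × θ̂)^*𝒫ⱼ| ≅ 𝒫ᵢ|` and the `λ`-clause `λᵢ| ≫ θ̂ = θ ≫ λⱼ|` of [MumfordFogartyKirwan1994,
Def. 7.2/7.3] (the dual and `λ` components of the transition isomorphisms of triples).  OUTPUT:

* §1 the overlap data of ★ FILE B `PolarizationChartDatum` for `𝔊.zariskiGluingDatum` (`D₂`, `lam₂` by ★
  `DualPair.baseChange` / `Polarization.baseChange` twice; `Ĝ₁` = projections, `Ĝ₂` = `θ̂` then projection; Poincaré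
  clauses by ★ `nonempty_pullback_map_P_iso_baseChange_P` ∘ FILE A `nonempty_pullback_map_comp_iso`);
* §2 **`𝔊.polarizationChartDatum`**; for a dual pair `D₀` of the GLUED abelian scheme (road (D-F3): [MumfordFogartyKirwan1994,
  Cor. 6.8] applied to `⋃ Aᵢ → A⁰`) **`𝔊.polarizationDatum D₀`** (over locally Noetherian slices under the unit hypotheses; no
  connectedness, ★ `AbelianSchemeDualTransportOfBaseChangeAnyBase`) and **`𝔊.polarization D₀ : 𝔊.abelianScheme.Polarization D₀`** (★ (P1)), with the chart clauses;
* §3 **`𝔊.glueTriple`** — adding slice level structures compatible with `θ` (★ FILE 6 `levelDatum`): the glued TRIPLE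
  `PolarizedAbelianSchemeWithLevel g N δ D.glued` of [MumfordFogartyKirwan1994, Def. 7.2] (★ (P3)), with CARTESIAN CHARTS
  **`isBaseChangeVia_chartTriple`** (all five clauses of ★ `PolarizedAbelianSchemeWithLevel.IsBaseChangeVia`) — the F-8
  (8c) recipe end to end: slices `V_R` ⇒ ★ `OpensGlueDatum.glueData` ⇒ `CocycleDatum` ⇒ the universal triple over `A⁰`,
  given the dual pair `D₀` of the glued family (F-3).

No named fact, no `sorry`, no instance, no notation.  HC_CM is proved only modulo the printed citations until rung 0
closes; this file discharges none of them.

## References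
* [MumfordFogartyKirwan1994] D. Mumford, J. Fogarty, F. Kirwan, *Geometric Invariant Theory*, 3rd ed. (1994), Ch. 6 §1
  Cor. 6.8 (p. 118); §2 Def. 6.3 (p. 120); Ch. 7 §2 Def. 7.2 (p. 129), Def. 7.3 (p. 129).
* [StacksProject] The Stacks Project, Tag 01LH (Relative glueing).
* [MilneAV2008] J. S. Milne, *Abelian Varieties* (v2.00, 2008), I §8 pp. 36–37.
* [GortzWedhorn2020] U. Görtz, T. Wedhorn, *Algebraic Geometry I*, 2nd ed. (2020), Section (3.3) Prop. 3.5.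
-/

universe u

open CategoryTheory CategoryTheory.Limits AlgebraicGeometry MonoidalCategory
open Literature.AlgebraicGeometry.Morphisms

noncomputable section

namespace Literature.AlgebraicGeometry.AbelianSchemes

namespace AbelianSchemeOver

/-- `pullback.map` with the SAME component maps over two (equal) base maps is the same morphism: it is determined by its
two components (used to realign the base map of a Poincaré clause along an equality such as
`(V(i,j) ≅ Uᵢ ×_{A⁰} Uⱼ) ≫ pr = D.f i j`). [cite: StacksProject, Tag 01LH] -/
theorem pullback_map_congr_base {X₁ Y₁ Z₁ X₂ Y₂ Z₂ : Scheme.{u}} {f₁ : X₁ ⟶ Z₁} {g₁ : Y₁ ⟶ Z₁} {f₂ : X₂ ⟶ Z₂}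
    {g₂ : Y₂ ⟶ Z₂} (i₁ : X₁ ⟶ X₂) (i₂ : Y₁ ⟶ Y₂) (i₃ i₃' : Z₁ ⟶ Z₂) (e₁ : f₁ ≫ i₃ = i₁ ≫ f₂)
    (e₂ : g₁ ≫ i₃ = i₂ ≫ g₂) (e₁' : f₁ ≫ i₃' = i₁ ≫ f₂) (e₂' : g₁ ≫ i₃' = i₂ ≫ g₂) :
    pullback.map f₁ g₁ f₂ g₂ i₁ i₂ i₃ e₁ e₂ = pullback.map f₁ g₁ f₂ g₂ i₁ i₂ i₃' e₁' e₂' :=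
  pullback.hom_ext ((pullback.lift_fst _ _ _).trans (pullback.lift_fst _ _ _).symm)
    ((pullback.lift_snd _ _ _).trans (pullback.lift_snd _ _ _).symm)

/-- Two commutative squares side by side: `a ≫ e = p ≫ b` and `b ≫ f = q ≫ c` give `a ≫ (e ≫ f) = (p ≫ q) ≫ c`
(stated in an abstract category so that consumers whose objects agree only up to unfolding can apply it in term
mode). [cite: StacksProject, Tag 01LH] -/
theorem comp_sq_of_sq {C : Type*} [Category C] {X Y Z W X' X'' : C} {a : X ⟶ Y} {e : Y ⟶ Z} {f : Z ⟶ W}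
    {p : X ⟶ X'} {b : X' ⟶ Z} {q : X' ⟶ X''} {c : X'' ⟶ W} (h₁ : a ≫ e = p ≫ b) (h₂ : b ≫ f = q ≫ c) :
    a ≫ e ≫ f = (p ≫ q) ≫ c := by
  rw [← Category.assoc, h₁, Category.assoc, h₂, ← Category.assoc]

namespace CocycleDatum

open scoped MonObj

variable {D : Scheme.GlueData.{u}} (𝔊 : CocycleDatum D) (Dc : ∀ i, (𝔊.A i).DualPair)
  (pol : ∀ i, (𝔊.A i).Polarization (Dc i))
  (θhat : ∀ i j, ((Dc i).baseChange (D.f i j)).hat.X.left ⟶ ((Dc j).baseChange (D.f j i)).hat.X.left)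

/-! ### §1 The overlap data: dual pairs, `λ`, charts of duals on `Uᵢ ×_{A⁰} Uⱼ` -/

/-- The dual pair of the overlap family `A₂ i j`: `Dᵢ` base-changed to `V(i,j)` and transported to `Uᵢ ×_{A⁰} Uⱼ` (★
`DualPair.baseChange` twice, exactly as FILE 5 builds `A₂ i j`). [cite: MumfordFogartyKirwan1994, Ch. 6 §1 Cor. 6.8 (p. 118)] -/
def D₂ (i j : D.J) : (𝔊.A₂ i j).DualPair :=
  ((Dc i).baseChange (D.f i j)).baseChange (isPullback_V D i j).isoPullback.inv

/-- The base-changed `λᵢ` on the overlap family `A₂ i j` (★ `Polarization.baseChange` twice), as a morphism of total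
spaces. [cite: MumfordFogartyKirwan1994, Ch. 6 §2 Definition 6.3 (p. 120)] -/
def lam₂ (i j : D.J) : (𝔊.A₂ i j).X.left ⟶ (𝔊.D₂ Dc i j).hat.X.left :=
  (((pol i).baseChange (D.f i j)).baseChange (isPullback_V D i j).isoPullback.inv).lam.left

/-- The chart of duals `Ĝ₁ : Â₂ → Âᵢ` over `pr₁ : Uᵢ ×_{A⁰} Uⱼ → Uᵢ`: the two projections (as `κ₁` of FILE 5).
[cite: MumfordFogartyKirwan1994, Ch. 7 §2 Definition 7.2 (p. 129)] -/
def Ĝ₁ (i j : D.J) : (𝔊.D₂ Dc i j).hat.X.left ⟶ (Dc i).hat.X.left :=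
  pullback.fst _ _ ≫ pullback.fst (Dc i).hat.X.hom (D.f i j)

/-- The chart of duals `Ĝ₂ : Â₂ → Âⱼ` over `pr₂`: the projection, `θ̂ i j`, the projection (as `κ₂` of FILE 5).
[cite: MumfordFogartyKirwan1994, Ch. 7 §2 Definition 7.2 (p. 129)] -/
def Ĝ₂ (i j : D.J) : (𝔊.D₂ Dc i j).hat.X.left ⟶ (Dc j).hat.X.left :=
  (pullback.fst _ _ ≫ θhat i j) ≫ pullback.fst (Dc j).hat.X.hom (D.f j i)

/-- The slice square commutes: `(Aᵢ)|_{V} → V → Uᵢ` is `pr ≫ (Aᵢ → Uᵢ)`. [cite: MumfordFogartyKirwan1994, Ch. 7 §2 Definition 7.2 (p. 129)] -/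
theorem wA_bc (i j : D.J) :
    ((𝔊.A i).baseChange (D.f i j)).X.hom ≫ D.f i j = pullback.fst (𝔊.A i).X.hom (D.f i j) ≫ (𝔊.A i).X.hom :=
  (pullback.condition (f := (𝔊.A i).X.hom) (g := D.f i j)).symm

/-- The slice square of duals commutes. [cite: MumfordFogartyKirwan1994, Ch. 7 §2 Definition 7.2 (p. 129)] -/
theorem wH_bc (i j : D.J) :
    ((Dc i).baseChange (D.f i j)).hat.X.hom ≫ D.f i j = pullback.fst (Dc i).hat.X.hom (D.f i j) ≫ (Dc i).hat.X.hom :=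
  (pullback.condition (f := (Dc i).hat.X.hom) (g := D.f i j)).symm

/-- The transport square to `Uᵢ ×_{A⁰} Uⱼ` commutes (family). [cite: MumfordFogartyKirwan1994, Ch. 7 §2 Definition 7.2 (p. 129)] -/
theorem wA₂ (i j : D.J) :
    (𝔊.A₂ i j).X.hom ≫ (isPullback_V D i j).isoPullback.inv =
      pullback.fst ((𝔊.A i).baseChange (D.f i j)).X.hom (isPullback_V D i j).isoPullback.inv ≫
        ((𝔊.A i).baseChange (D.f i j)).X.hom :=
  (pullback.condition (f := ((𝔊.A i).baseChange (D.f i j)).X.hom) (g := (isPullback_V D i j).isoPullback.inv)).symm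

/-- The transport square to `Uᵢ ×_{A⁰} Uⱼ` commutes (duals). [cite: MumfordFogartyKirwan1994, Ch. 7 §2 Definition 7.2 (p. 129)] -/
theorem wH₂ (i j : D.J) :
    (𝔊.D₂ Dc i j).hat.X.hom ≫ (isPullback_V D i j).isoPullback.inv =
      pullback.fst ((Dc i).baseChange (D.f i j)).hat.X.hom (isPullback_V D i j).isoPullback.inv ≫
        ((Dc i).baseChange (D.f i j)).hat.X.hom :=
  (pullback.condition (f := ((Dc i).baseChange (D.f i j)).hat.X.hom) (g := (isPullback_V D i j).isoPullback.inv)).symm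

/-- **The Poincaré clause along `(κ₁, Ĝ₁)` over `pr₁`**: two base-change clauses composed, base map realigned along
`(V ≅ Uᵢ ×_{A⁰} Uⱼ)⁻¹ ≫ D.f i j = pr₁`. [cite: MumfordFogartyKirwan1994, Ch. 7 §2 Definition 7.3 (p. 129)] -/
theorem poincare₁ (i j : D.J) :
    ∃ (wG : (𝔊.A₂ i j).X.hom ≫ pullback.fst (D.ι i) (D.ι j) = 𝔊.zariskiGluingDatum.κ₁ i j ≫ (𝔊.A i).X.hom)
      (wĜ : (𝔊.D₂ Dc i j).hat.X.hom ≫ pullback.fst (D.ι i) (D.ι j) = 𝔊.Ĝ₁ Dc i j ≫ (Dc i).hat.X.hom),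
      Nonempty ((Scheme.Modules.pullback (pullback.map (𝔊.A₂ i j).X.hom (𝔊.D₂ Dc i j).hat.X.hom (𝔊.A i).X.hom
        (Dc i).hat.X.hom (𝔊.zariskiGluingDatum.κ₁ i j) (𝔊.Ĝ₁ Dc i j) (pullback.fst (D.ι i) (D.ι j)) wG wĜ)).obj
          (Dc i).P ≅ (𝔊.D₂ Dc i j).P) := by
  have hb : (isPullback_V D i j).isoPullback.inv ≫ D.f i j = pullback.fst (D.ι i) (D.ι j) :=
    (isPullback_V D i j).isoPullback_inv_fst
  -- the composite clause over `e⁻¹ ≫ D.f i j`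
  have wG'' : (𝔊.A₂ i j).X.hom ≫ (isPullback_V D i j).isoPullback.inv ≫ D.f i j =
      (pullback.fst ((𝔊.A i).baseChange (D.f i j)).X.hom (isPullback_V D i j).isoPullback.inv ≫
        pullback.fst (𝔊.A i).X.hom (D.f i j)) ≫ (𝔊.A i).X.hom :=
    comp_sq_of_sq (𝔊.wA₂ i j) (𝔊.wA_bc i j)
  have wĜ'' : (𝔊.D₂ Dc i j).hat.X.hom ≫ (isPullback_V D i j).isoPullback.inv ≫ D.f i j =
      (pullback.fst ((Dc i).baseChange (D.f i j)).hat.X.hom (isPullback_V D i j).isoPullback.inv ≫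
        pullback.fst (Dc i).hat.X.hom (D.f i j)) ≫ (Dc i).hat.X.hom :=
    comp_sq_of_sq (𝔊.wH₂ Dc i j) (𝔊.wH_bc Dc i j)
  have hc := DualPair.nonempty_pullback_map_comp_iso (Dc i) ((Dc i).baseChange (D.f i j)) (𝔊.D₂ Dc i j)
    (𝔊.wA_bc i j) (𝔊.wH_bc Dc i j) (𝔊.wA₂ i j) (𝔊.wH₂ Dc i j)
    ((Dc i).nonempty_pullback_map_P_iso_baseChange_P (D.f i j) (𝔊.wA_bc i j) (𝔊.wH_bc Dc i j))
    (((Dc i).baseChange (D.f i j)).nonempty_pullback_map_P_iso_baseChange_P (isPullback_V D i j).isoPullback.inv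
      (𝔊.wA₂ i j) (𝔊.wH₂ Dc i j)) wG'' wĜ''
  have wG : (𝔊.A₂ i j).X.hom ≫ pullback.fst (D.ι i) (D.ι j) = 𝔊.zariskiGluingDatum.κ₁ i j ≫ (𝔊.A i).X.hom :=
    (congrArg ((𝔊.A₂ i j).X.hom ≫ ·) hb).symm.trans wG''
  have wĜ : (𝔊.D₂ Dc i j).hat.X.hom ≫ pullback.fst (D.ι i) (D.ι j) = 𝔊.Ĝ₁ Dc i j ≫ (Dc i).hat.X.hom :=
    (congrArg ((𝔊.D₂ Dc i j).hat.X.hom ≫ ·) hb).symm.trans wĜ''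
  refine ⟨wG, wĜ, ?_⟩
  obtain ⟨e⟩ := hc
  exact ⟨(Scheme.Modules.pullbackCongr (pullback_map_congr_base _ _ _ _ wG wĜ wG'' wĜ'')).app (Dc i).P ≪≫ e⟩

variable (hθhat : ∀ i j, ∃ (wG : ((𝔊.A i).baseChange (D.f i j)).X.hom ≫ D.t i j =
      𝔊.θ i j ≫ ((𝔊.A j).baseChange (D.f j i)).X.hom)
    (wĜ : ((Dc i).baseChange (D.f i j)).hat.X.hom ≫ D.t i j = θhat i j ≫ ((Dc j).baseChange (D.f j i)).hat.X.hom),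
    Nonempty ((Scheme.Modules.pullback (pullback.map ((𝔊.A i).baseChange (D.f i j)).X.hom
      ((Dc i).baseChange (D.f i j)).hat.X.hom ((𝔊.A j).baseChange (D.f j i)).X.hom
      ((Dc j).baseChange (D.f j i)).hat.X.hom (𝔊.θ i j) (θhat i j) (D.t i j) wG wĜ)).obj
        ((Dc j).baseChange (D.f j i)).P ≅ ((Dc i).baseChange (D.f i j)).P))
  (hlam : ∀ i j, ((pol i).baseChange (D.f i j)).lam.left ≫ θhat i j =
    𝔊.θ i j ≫ ((pol j).baseChange (D.f j i)).lam.left)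

include hθhat in
/-- **The Poincaré clause along `(κ₂, Ĝ₂)` over `pr₂`**: base change to the overlap, the transition clause `hθhat`, base
change from slice `j`, composed; base map `(e⁻¹ ≫ D.t i j) ≫ D.f j i = pr₂`. [cite: MumfordFogartyKirwan1994, Ch. 7 §2 Definition 7.3 (p. 129)] -/
theorem poincare₂ (i j : D.J) :
    ∃ (wG : (𝔊.A₂ i j).X.hom ≫ pullback.snd (D.ι i) (D.ι j) = 𝔊.zariskiGluingDatum.κ₂ i j ≫ (𝔊.A j).X.hom)
      (wĜ : (𝔊.D₂ Dc i j).hat.X.hom ≫ pullback.snd (D.ι i) (D.ι j) = 𝔊.Ĝ₂ Dc θhat i j ≫ (Dc j).hat.X.hom),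
      Nonempty ((Scheme.Modules.pullback (pullback.map (𝔊.A₂ i j).X.hom (𝔊.D₂ Dc i j).hat.X.hom (𝔊.A j).X.hom
        (Dc j).hat.X.hom (𝔊.zariskiGluingDatum.κ₂ i j) (𝔊.Ĝ₂ Dc θhat i j) (pullback.snd (D.ι i) (D.ι j)) wG wĜ)).obj
          (Dc j).P ≅ (𝔊.D₂ Dc i j).P) := by
  obtain ⟨wGθ, wĜθ, hPθ⟩ := hθhat i j
  have hb : ((isPullback_V D i j).isoPullback.inv ≫ D.t i j) ≫ D.f j i = pullback.snd (D.ι i) (D.ι j) := by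
    rw [Category.assoc]
    exact (isPullback_V D i j).isoPullback_inv_snd
  -- clause (a)+(b): over `e⁻¹ ≫ D.t i j`, maps `(pr ≫ θ, pr ≫ θ̂)`
  have wGab : (𝔊.A₂ i j).X.hom ≫ (isPullback_V D i j).isoPullback.inv ≫ D.t i j =
      (pullback.fst ((𝔊.A i).baseChange (D.f i j)).X.hom (isPullback_V D i j).isoPullback.inv ≫ 𝔊.θ i j) ≫
        ((𝔊.A j).baseChange (D.f j i)).X.hom :=
    comp_sq_of_sq (𝔊.wA₂ i j) wGθ
  have wĜab : (𝔊.D₂ Dc i j).hat.X.hom ≫ (isPullback_V D i j).isoPullback.inv ≫ D.t i j =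
      (pullback.fst ((Dc i).baseChange (D.f i j)).hat.X.hom (isPullback_V D i j).isoPullback.inv ≫ θhat i j) ≫
        ((Dc j).baseChange (D.f j i)).hat.X.hom :=
    comp_sq_of_sq (𝔊.wH₂ Dc i j) wĜθ
  have hab := DualPair.nonempty_pullback_map_comp_iso ((Dc j).baseChange (D.f j i)) ((Dc i).baseChange (D.f i j))
    (𝔊.D₂ Dc i j) wGθ wĜθ (𝔊.wA₂ i j) (𝔊.wH₂ Dc i j) hPθ
    (((Dc i).baseChange (D.f i j)).nonempty_pullback_map_P_iso_baseChange_P (isPullback_V D i j).isoPullback.inv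
      (𝔊.wA₂ i j) (𝔊.wH₂ Dc i j)) wGab wĜab
  -- clause (c): the slice-`j` base change, then compose over `(e⁻¹ ≫ t) ≫ D.f j i`
  have wG'' : (𝔊.A₂ i j).X.hom ≫ ((isPullback_V D i j).isoPullback.inv ≫ D.t i j) ≫ D.f j i =
      ((pullback.fst ((𝔊.A i).baseChange (D.f i j)).X.hom (isPullback_V D i j).isoPullback.inv ≫ 𝔊.θ i j) ≫
        pullback.fst (𝔊.A j).X.hom (D.f j i)) ≫ (𝔊.A j).X.hom :=
    comp_sq_of_sq wGab (𝔊.wA_bc j i)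
  have wĜ'' : (𝔊.D₂ Dc i j).hat.X.hom ≫ ((isPullback_V D i j).isoPullback.inv ≫ D.t i j) ≫ D.f j i =
      ((pullback.fst ((Dc i).baseChange (D.f i j)).hat.X.hom (isPullback_V D i j).isoPullback.inv ≫ θhat i j) ≫
        pullback.fst (Dc j).hat.X.hom (D.f j i)) ≫ (Dc j).hat.X.hom :=
    comp_sq_of_sq wĜab (𝔊.wH_bc Dc j i)
  have hc := DualPair.nonempty_pullback_map_comp_iso (Dc j) ((Dc j).baseChange (D.f j i)) (𝔊.D₂ Dc i j)
    (𝔊.wA_bc j i) (𝔊.wH_bc Dc j i) wGab wĜab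
    ((Dc j).nonempty_pullback_map_P_iso_baseChange_P (D.f j i) (𝔊.wA_bc j i) (𝔊.wH_bc Dc j i)) hab wG'' wĜ''
  have wG : (𝔊.A₂ i j).X.hom ≫ pullback.snd (D.ι i) (D.ι j) = 𝔊.zariskiGluingDatum.κ₂ i j ≫ (𝔊.A j).X.hom :=
    (congrArg ((𝔊.A₂ i j).X.hom ≫ ·) hb).symm.trans wG''
  have wĜ : (𝔊.D₂ Dc i j).hat.X.hom ≫ pullback.snd (D.ι i) (D.ι j) = 𝔊.Ĝ₂ Dc θhat i j ≫ (Dc j).hat.X.hom :=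
    (congrArg ((𝔊.D₂ Dc i j).hat.X.hom ≫ ·) hb).symm.trans wĜ''
  refine ⟨wG, wĜ, ?_⟩
  obtain ⟨e⟩ := hc
  exact ⟨(Scheme.Modules.pullbackCongr (pullback_map_congr_base _ _ _ _ wG wĜ wG'' wĜ'')).app (Dc j).P ≪≫ e⟩

/-- **The `λ`-clause along `κ₁`**: `λ₂ ≫ Ĝ₁ = κ₁ ≫ λᵢ` (★ `Polarization.baseChange_lam_left_comp_fst` twice).
[cite: MumfordFogartyKirwan1994, Ch. 7 §2 Definition 7.2 (p. 129)] -/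
theorem lam₂_Ĝ₁ (i j : D.J) :
    𝔊.lam₂ Dc pol i j ≫ 𝔊.Ĝ₁ Dc i j = 𝔊.zariskiGluingDatum.κ₁ i j ≫ (pol i).lam.left := by
  have h1 := ((pol i).baseChange (D.f i j)).baseChange_lam_left_comp_fst (isPullback_V D i j).isoPullback.inv
  have h2 := (pol i).baseChange_lam_left_comp_fst (D.f i j)
  exact (Category.assoc _ _ _).symm.trans
    ((congrArg (· ≫ pullback.fst (Dc i).hat.X.hom (D.f i j)) h1).trans
      ((Category.assoc _ _ _).trans
        ((congrArg (pullback.fst ((𝔊.A i).baseChange (D.f i j)).X.hom (isPullback_V D i j).isoPullback.inv ≫ ·)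
          h2).trans (Category.assoc _ _ _).symm)))

include hlam in
/-- **The `λ`-clause along `κ₂`**: `λ₂ ≫ Ĝ₂ = κ₂ ≫ λⱼ` (base change, the transition `λ`-clause `hlam`, base change).
[cite: MumfordFogartyKirwan1994, Ch. 7 §2 Definition 7.2 (p. 129)] -/
theorem lam₂_Ĝ₂ (i j : D.J) :
    𝔊.lam₂ Dc pol i j ≫ 𝔊.Ĝ₂ Dc θhat i j = 𝔊.zariskiGluingDatum.κ₂ i j ≫ (pol j).lam.left := by
  have h1 := ((pol i).baseChange (D.f i j)).baseChange_lam_left_comp_fst (isPullback_V D i j).isoPullback.inv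
  have h2 := hlam i j
  have h3 := (pol j).baseChange_lam_left_comp_fst (D.f j i)
  -- `λ₂ ≫ ((pr ≫ θ̂) ≫ pr) = ((λ₂ ≫ pr) ≫ θ̂) ≫ pr = ((pr ≫ λᵢ|) ≫ θ̂) ≫ pr = (pr ≫ (θ ≫ λⱼ|)) ≫ pr = …`
  exact (Category.assoc _ _ _).symm.trans
    ((congrArg (· ≫ pullback.fst (Dc j).hat.X.hom (D.f j i))
      ((Category.assoc _ _ _).symm.trans
        ((congrArg (· ≫ θhat i j) h1).trans
          ((Category.assoc _ _ _).trans
            ((congrArg (pullback.fst ((𝔊.A i).baseChange (D.f i j)).X.hom (isPullback_V D i j).isoPullback.inv ≫ ·)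
              h2).trans (Category.assoc _ _ _).symm))))).trans
      ((Category.assoc _ _ _).trans
        ((congrArg ((pullback.fst ((𝔊.A i).baseChange (D.f i j)).X.hom (isPullback_V D i j).isoPullback.inv ≫
            𝔊.θ i j) ≫ ·) h3).trans (Category.assoc _ _ _).symm)))

/-! ### §2 The chart datum and the charts of duals `Ĝᵢ` -/

include hθhat hlam in
/-- **The FILE B `PolarizationChartDatum` on the Zariski gluing datum of FILE 5, read off the slice polarisations and the
transition data** (the polarisation analogue of ★ FILE 6 `levelDatum`). [cite: MumfordFogartyKirwan1994, Ch. 7 §2 Definition 7.2 (p. 129)]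
[cite: MumfordFogartyKirwan1994, Ch. 6 §2 Definition 6.3 (p. 120)] -/
def polarizationChartDatum : 𝔊.zariskiGluingDatum.PolarizationChartDatum where
  Dc := Dc
  pol := pol
  D₂ := 𝔊.D₂ Dc
  lam₂ := 𝔊.lam₂ Dc pol
  Ĝ₁ := 𝔊.Ĝ₁ Dc
  Ĝ₂ := 𝔊.Ĝ₂ Dc θhat
  poincare₁ := 𝔊.poincare₁ Dc
  poincare₂ := 𝔊.poincare₂ Dc θhat hθhat
  lam₂_Ĝ₁ := 𝔊.lam₂_Ĝ₁ Dc pol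
  lam₂_Ĝ₂ := 𝔊.lam₂_Ĝ₂ Dc pol θhat hlam

/-- The dual pairs of the chart datum are the slice dual pairs (definitional). [cite: MumfordFogartyKirwan1994, Ch. 6 §1 Cor. 6.8 (p. 118)] -/
theorem polarizationChartDatum_Dc : (𝔊.polarizationChartDatum Dc pol θhat hθhat hlam).Dc = Dc := rfl

/-- The polarisations of the chart datum are the slice polarisations (definitional). [cite: MumfordFogartyKirwan1994, Ch. 6 §2 Definition 6.3 (p. 120)] -/
theorem polarizationChartDatum_pol : (𝔊.polarizationChartDatum Dc pol θhat hθhat hlam).pol = pol := rfl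

variable (D₀ : 𝔊.abelianScheme.DualPair)

/-- **The chart of duals `Ĝᵢ : Âᵢ → Ẑ` over `Uᵢ ↪ A⁰`** for the slice `i`: the dual transport along the cartesian chart
`Aᵢ ↪ ⋃ Aᵢ` (FILE B `PolarizationChartDatum.Ĝ`, FILE A `hatTransportOfBaseChange`). [cite: MilneAV2008, I §8 pp. 36–37]
[cite: MumfordFogartyKirwan1994, Ch. 6 §1 Cor. 6.8 (p. 118)] -/
def Ĝ (i : D.J) : (Dc i).hat.X.left ⟶ D₀.hat.X.left :=
  (𝔊.polarizationChartDatum Dc pol θhat hθhat hlam).Ĝ D₀ i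

/-- **The Poincaré clause `(ιᵢ × Ĝᵢ)^*𝒫₀ ≅ 𝒫ᵢ` of the chart square** (FILE B `poincare`).
[cite: MumfordFogartyKirwan1994, Ch. 7 §2 Definition 7.3 (p. 129)] [cite: MilneAV2008, I §8 pp. 36–37] -/
theorem poincare (i : D.J) :
    ∃ (wG : (𝔊.A i).X.hom ≫ D.ι i = 𝔊.total.ι i ≫ 𝔊.abelianScheme.X.hom)
      (wĜ : (Dc i).hat.X.hom ≫ D.ι i = 𝔊.Ĝ Dc pol θhat hθhat hlam D₀ i ≫ D₀.hat.X.hom),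
      Nonempty ((Scheme.Modules.pullback (pullback.map (𝔊.A i).X.hom (Dc i).hat.X.hom 𝔊.abelianScheme.X.hom
        D₀.hat.X.hom (𝔊.total.ι i) (𝔊.Ĝ Dc pol θhat hθhat hlam D₀ i) (D.ι i) wG wĜ)).obj D₀.P ≅ (Dc i).P) :=
  (𝔊.polarizationChartDatum Dc pol θhat hθhat hlam).poincare D₀ i

/-! ### §3 The glued polarisation and the glued TRIPLE over `A⁰ = D.glued`, with cartesian charts -/

open Literature.AlgebraicGeometry.ModuliOfAbelianVarieties (IsPolarizationType)

variable {g N : ℕ} {δ : Fin g → ℕ} (φ : ∀ i, (𝔊.A i).LevelStructure g N)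
  (hφ : ∀ i j, ((φ i).baseChange (D.f i j)).IsBaseChangeVia ((φ j).baseChange (D.f j i)) (D.t i j) (𝔊.θ i j))
  (hrel : ∀ i, (𝔊.A i).IsOfRelDim g) (hδ : IsPolarizationType δ) (hT : ∀ i, (pol i).HasType δ)
  (hsym : ∀ i, (φ i).IsSymplecticLiftable (pol i) δ)
  -- (edition 2, repair road R2⁺: the hat-normalisations, moved up so that `chartTriple` can carry its field)
  (unit₀ : Nonempty ((Scheme.Modules.pullback (DualPair.unitHatSlice D₀)).obj D₀.P ≅ SheafOfModules.unit _))
  (unit : ∀ i, Nonempty ((Scheme.Modules.pullback (DualPair.unitHatSlice (Dc i))).obj (Dc i).P ≅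
    SheafOfModules.unit _))

/-- **The slice triple `(Aᵢ, Dᵢ, λᵢ, φᵢ)` over `Uᵢ`** reassembled (★ (P3) `chartTriple`). [cite: MumfordFogartyKirwan1994, Ch. 7 §2 Definition 7.2 (p. 129)] -/
def chartTriple (i : D.J) : PolarizedAbelianSchemeWithLevel g N δ (D.U i) where
  A := 𝔊.A i
  relDim := hrel i
  D := Dc i
  pol := pol i
  hasType := hT i
  level := φ i
  symplectic := hsym i
  hatNormalised := unit i

/-- The abelian scheme of the slice triple (definitional). [cite: MumfordFogartyKirwan1994, Ch. 7 §2 Definition 7.2 (p. 129)] -/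
theorem chartTriple_A (i : D.J) : (𝔊.chartTriple Dc pol φ hrel hT hsym unit i).A = 𝔊.A i := rfl

variable [hN : ∀ i, IsLocallyNoetherian (D.U i)]

/-- **The ★ (P1) `PolarizationDatum` over the glued base `A⁰`** from slice polarisations, transition data and a dual pair
`D₀` of the glued family, over locally Noetherian slices under the unit hypotheses `𝒫|_{A × {ε_Â}} ≅ 𝒪` (FILE B
`toPolarizationDatum` on the connectedness-free discharge ★ `hĜ_of_isLocallyNoetherian_base`).
[cite: MumfordFogartyKirwan1994, Ch. 7 §2 Definition 7.2 (p. 129)] [cite: MumfordFogartyKirwan1994, Ch. 6 §1 Cor. 6.8 (p. 118)] -/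
def polarizationDatum : 𝔊.zariskiGluingDatum.PolarizationDatum D₀ :=
  haveI : ∀ i, IsLocallyNoetherian (𝔊.zariskiGluingDatum.𝒰.X i) := fun i => hN i
  (𝔊.polarizationChartDatum Dc pol θhat hθhat hlam).toPolarizationDatum D₀
    ((𝔊.polarizationChartDatum Dc pol θhat hθhat hlam).hĜ_of_isLocallyNoetherian_base D₀ unit₀ unit)

/-- **THE GLUED POLARISATION `λ : ⋃ Aᵢ → Ẑ` of the glued abelian scheme over `A⁰`** with respect to `D₀` (★ (P1)
`PolarizationDatum.polarization`: both clauses of [MumfordFogartyKirwan1994, Def. 6.3] are local on the base).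
[cite: MumfordFogartyKirwan1994, Ch. 6 §2 Definition 6.3 (p. 120)] [cite: StacksProject, Tag 01LH] -/
def polarization : 𝔊.abelianScheme.Polarization D₀ :=
  (𝔊.polarizationDatum Dc pol θhat hθhat hlam D₀ unit₀ unit).polarization

/-- **Every slice polarisation IS the restriction of the glued one**: the `λ`-clause `λᵢ ≫ Ĝᵢ = ιᵢ ≫ λ` of
[MumfordFogartyKirwan1994, Def. 7.2] for the chart square `(Aᵢ ↪ ⋃ Aᵢ, Ĝᵢ)` over `Uᵢ ↪ A⁰` (★ (P1)
`pol_lam_left_comp_Ĝ`). [cite: MumfordFogartyKirwan1994, Ch. 7 §2 Definition 7.2 (p. 129)] [cite: StacksProject, Tag 01LH] -/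
theorem pol_lam_left_comp_Ĝ (i : D.J) :
    (pol i).lam.left ≫ 𝔊.Ĝ Dc pol θhat hθhat hlam D₀ i =
      𝔊.total.ι i ≫ (𝔊.polarization Dc pol θhat hθhat hlam D₀ unit₀ unit).lam.left :=
  (𝔊.polarizationDatum Dc pol θhat hθhat hlam D₀ unit₀ unit).pol_lam_left_comp_Ĝ i

include unit₀ unit in
/-- **The group-scheme clause**: `Ĝᵢ` exhibits `Âᵢ` as the base change of `Ẑ` along `Uᵢ ↪ A⁰` AS GROUP SCHEMES, over
connected locally Noetherian slices under the unit hypotheses (FILE B `hĜ_of_isLocallyNoetherian`).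
[cite: MumfordFogartyKirwan1994, Ch. 6 §1 Cor. 6.8 (p. 118)] [cite: MilneAV2008, I §8 pp. 36–37] -/
theorem hat_isBaseChangeVia_Ĝ (i : D.J) :
    (Dc i).hat.IsBaseChangeVia D₀.hat (D.ι i) (𝔊.Ĝ Dc pol θhat hθhat hlam D₀ i) :=
  (𝔊.polarizationDatum Dc pol θhat hθhat hlam D₀ unit₀ unit).hĜ i

/-- **THE GLUED TRIPLE `(⋃ Aᵢ → A⁰, λ, φ)` of [MumfordFogartyKirwan1994, Def. 7.2] over the glued base** from slice triples
`(Aᵢ, Dᵢ, λᵢ, φᵢ)`, transition data `(θ, θ̂)` with their clauses, and a dual pair `D₀` of the glued family (★ (P3)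
`PolarizationDatum.glueTriple` on `𝔊.polarizationDatum D₀` and ★ FILE 6 `levelDatum`), over locally Noetherian slices under
the unit hypotheses. [cite: MumfordFogartyKirwan1994, Ch. 7 §2 Definition 7.2 (p. 129)] [cite: StacksProject, Tag 01LH] -/
def glueTriple : PolarizedAbelianSchemeWithLevel g N δ D.glued :=
  (𝔊.polarizationDatum Dc pol θhat hθhat hlam D₀ unit₀ unit).glueTriple (𝔊.levelDatum φ hφ) hrel hδ hT hsym unit₀

/-- The abelian scheme of the glued triple is the glued abelian scheme `⋃ Aᵢ → A⁰` (definitional).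
[cite: MumfordFogartyKirwan1994, Ch. 7 §2 Definition 7.2 (p. 129)] -/
theorem glueTriple_A :
    (𝔊.glueTriple Dc pol θhat hθhat hlam D₀ φ hφ hrel hδ hT hsym unit₀ unit).A = 𝔊.abelianScheme := rfl

/-- The dual pair of the glued triple is the given `D₀` (definitional). [cite: MumfordFogartyKirwan1994, Ch. 6 §1 Cor. 6.8 (p. 118)] -/
theorem glueTriple_D : (𝔊.glueTriple Dc pol θhat hθhat hlam D₀ φ hφ hrel hδ hT hsym unit₀ unit).D = D₀ := rfl

/-- The polarisation of the glued triple is the glued polarisation (definitional). [cite: MumfordFogartyKirwan1994, Ch. 6 §2 Definition 6.3 (p. 120)] -/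
theorem glueTriple_pol :
    (𝔊.glueTriple Dc pol θhat hθhat hlam D₀ φ hφ hrel hδ hT hsym unit₀ unit).pol =
      𝔊.polarization Dc pol θhat hθhat hlam D₀ unit₀ unit := rfl

/-- The level structure of the glued triple is the glued level structure of ★ FILE 6 (definitional).
[cite: MumfordFogartyKirwan1994, Ch. 7 §2 Definition 7.1 (p. 129)] -/
theorem glueTriple_level :
    (𝔊.glueTriple Dc pol θhat hθhat hlam D₀ φ hφ hrel hδ hT hsym unit₀ unit).level = 𝔊.levelStructure φ hφ := rfl

/-- **CARTESIAN CHARTS: every slice triple IS the pull-back of the glued triple along `Uᵢ ↪ A⁰`** via `(ιᵢ, Ĝᵢ)` — all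
five clauses of ★ `PolarizedAbelianSchemeWithLevel.IsBaseChangeVia` (★ (P3) `isBaseChangeVia_chartTriple`); with ★
`PolarizedAbelianSchemeWithLevelBaseChangeUnique` the slice triple is `glueTriple.baseChange (D.ι i)` up to a unique
isomorphism of triples. [cite: MumfordFogartyKirwan1994, Ch. 7 §2 Definition 7.2 (p. 129)] [cite: StacksProject, Tag 01LH] -/
theorem isBaseChangeVia_chartTriple (i : D.J) :
    (𝔊.chartTriple Dc pol φ hrel hT hsym unit i).IsBaseChangeVia
      (𝔊.glueTriple Dc pol θhat hθhat hlam D₀ φ hφ hrel hδ hT hsym unit₀ unit) (D.ι i) (𝔊.total.ι i)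
      (𝔊.Ĝ Dc pol θhat hθhat hlam D₀ i) :=
  (𝔊.polarizationDatum Dc pol θhat hθhat hlam D₀ unit₀ unit).isBaseChangeVia_chartTriple (𝔊.levelDatum φ hφ) hrel
    hδ hT hsym unit₀ unit i

/-- **Uniqueness of the glued polarisation among triples with these charts**: a polarisation `λ'` of the glued family
(for `D₀`) whose chart clauses are those of the `λᵢ` along the `Ĝᵢ` IS the glued one (★ (P3) `pol_lam_eq_of_chart`).
[cite: GortzWedhorn2020, Section (3.3) Proposition 3.5] [cite: MumfordFogartyKirwan1994, Ch. 6 §2 Definition 6.3 (p. 120)] -/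
theorem pol_lam_eq_of_chart (pol' : 𝔊.abelianScheme.Polarization D₀)
    (h : ∀ i, (pol i).lam.left ≫ 𝔊.Ĝ Dc pol θhat hθhat hlam D₀ i = 𝔊.total.ι i ≫ pol'.lam.left) :
    pol'.lam = (𝔊.glueTriple Dc pol θhat hθhat hlam D₀ φ hφ hrel hδ hT hsym unit₀ unit).pol.lam :=
  (𝔊.polarizationDatum Dc pol θhat hθhat hlam D₀ unit₀ unit).pol_lam_eq_of_chart (𝔊.levelDatum φ hφ) hrel hδ hT
    hsym unit₀ pol' h

end CocycleDatum

end AbelianSchemeOver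

end Literature.AlgebraicGeometry.AbelianSchemes

end
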